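import Summits.QuantumFields.YangMills.Theorems.UnitScaleTiltProp7TwistedIntertwiningRows
import Summits.QuantumFields.YangMills.Theorems.UnitScaleTiltProp7LandauCombDict
import Summits.QuantumFields.YangMills.Theorems.UnitScaleTiltProp7QprimeCombBumpSectionRows
import Summits.QuantumFields.YangMills.Theorems.PoincareLipschitzCovariantBridge
import Literature.MathematicalPhysics.QuantumFieldTheory.Balaban1983to89.B9B8AveragingKernelZd
import HarnessLib

/-!
# Route `UnitScaleTilt`, crux K1 «MinimiserStabilityRegPr» (stmt-QuantumFields-19200) — LANE II «DIVERGENCE RECOVERY AT CURVED `W`» (★★OWNER RULING №23), brick (B3-TUBE),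
# FILE T-1: **THE STRAIGHT COVARIANT TUBE AVERAGE `Q^{str}_W` — LETTERS, TELESCOPING, AND THE OPERATOR NORM `ℓ³‖Q^{str}_W f‖² ≤ (cB∕c₀)‖f‖²` (`CA = 1`)**
# in the slot shapes of ✓p706775 `Prop7DivRecoveryAssemblyCore.norm_sq_le_rows` (`T : E →ₗ[ℂ] E'`, `hT : ‖Tf‖² ≤ B‖f‖²`)

Cell `ym3-torus` ∕ width seat `ym-ust-19200-w1` (gen 15).  THEOREMS ONLY (0 `def`, 0 `sorry`); `--supports stmt-QuantumFields-19200 --as helper`, count-neutral.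
YM₃ on T³ is a ladder rung (R3), not d = 4, not infinite volume, not the Clay problem; nothing here claims the stub, the crux, `hN06`, (V3) or the mass gap.

THE PRINT.  [Balaban1985BackgroundPropagators] (3.14)–(3.16) p. 393: the averaging `Q_j(U)` of vector fields and the block pairing `Σ_j Σ_{b∈Λ_j} (L^jη)^{d−2}|(Q_j(U)A)(b)|²`;
(3.114) p. 418 «(QD^{L⁻¹}λ)(c) = R̄_c(Q′λ)(c₊) − (Q′λ)(c₋)»: along a STRAIGHT tube the covariant derivative telescopes.  [Balaban1984PropagatorsI] (1.18)–(1.20) p. 20 (the flat tube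
average `Q_k`); [Balaban1985Averaging] (9) p. 18 (parallel transport along words), (52)–(53) p. 27, (78) p. 30 (the comb contours `Γ^{(j)}_{y,x}` and their transporters).

WHY ((B7) PLAN 59f10769 §2, regime (I)).  The (REC) assembly works with an averaging `T` of ABSOLUTE operator norm in the `ℓ³`-currency; the averaging of record `Qkc W`
(comb legs) has `ℓ³‖Qkc 1 δ_b‖² ≈ ℓ∕6` (px19 g6 6cb8ac94), the straight tube has `CA = 1`.  THIS FILE fixes the tube letter and proves `CA = 1`; the `htube` row
(`Gc(Q′μ) ≤ 2‖T(Dμ)‖² + Ct·e²·‖μ‖²`) is FILE T-2 over the geometric input (B3-TUBE-geo) (FILE T-3).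

THE LETTER (no `def`; `T` is delivered as `∃ T` WITH ITS POINTWISE FORMULA).  `V := pull (bgUnits F K W) (basePt F n K)` (the `ℤ³` pull-back), `k := K − n`, `ℓ := Lᵏ`; for a coarse bond
`c : PBond (F.P n) 0`: `y := coordT3 F n K h c.src`, `κ := c.dir`, block `x ∈ blockIter L k y` (lit ✓`B9B8AveragingKernelZd`, THE SAME kernel as `Q′ = QprimeCombL2`:
✓`QprimeIter_zd_eq_sum_blockIter`), transporter `compT L (bgT L V) k y x · hol V x (seg κ j)` (`Q′`'s own composite comb to `x`, then the straight fine run), and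
`TS_W A c := (ℓ³)⁻¹ • Σ_{x} Σ_{j<ℓ} conjR (compT L (bgT L V) k y x · hol V x (seg κ j)) (A ⟨transl (basePt F n K) (x + j•e κ), κ⟩)`;
`T := η • toL2B ∘ TS_W ∘ toL2⁻¹ : BondL2K ℂ 3 (periodsT3 F K) c₀ W₂ →ₗ[ℂ] WL2 ℂ (fun _ : PBond (F.P n) 0 => cB) W₂` — the codomain of ✓`Qkc`, so that (EXCH) compares `T` and `Qkc W` in one space.

WHAT IS PROVED (ns `…Theorems.Prop7StraightTubeAverage`):
* §1 (lit `ℤᵈ` letters, any normed `ℂ`-algebra) ★`tube_telescope` — `Σ_{j<m} conjR (P·hol V x (seg κ j)) (η⁻¹ • (conjR (V (x+j•eκ) κ) (μ (x+(j+1)•eκ)) − μ (x+j•eκ)))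
  = η⁻¹ • (conjR (P·hol V x (seg κ m)) (μ (x + m•eκ)) − conjR P (μ x))` (no window).
* §2 (member) `norm_frobEquiv_symm_conjR_of_mem_unitaryUnits` (SU(2)∕unitary transports are Frobenius isometries), the counting rows `sum_coarse_blockIter_eq_sum_box`,
  `sum_tube_read_eq` (every fine bond is read by exactly `ℓ` pairs `(x, j)`), and ★★★`exists_tubeAvg` — `∃ T`, (formula) ∧ (hT) `∀ f, ℓ³·‖T f‖² ≤ (cB∕c₀)·‖f‖²`, on `RegPr F n K e W`
  (the transports are unitary there: ✓`LandauCombDict.bgT_pull_mem_unitaryUnits_of_regPr`, ✓`pull_bgUnits_mem_unitaryUnits`).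
HONEST SCOPE.  Letters + Cauchy–Schwarz + counting; no curvature estimate here (that is (B3-TUBE-geo)); rung R3, not Clay; YM gap NOT proved.

References: T. Bałaban, CMP **99** (1985) 389–434 [Balaban1985BackgroundPropagators]; CMP **95** (1984) 17–40 [Balaban1984PropagatorsI]; CMP **98** (1985) 17–51 [Balaban1985Averaging].
-/

set_option autoImplicit false

noncomputable section

open scoped Matrix.Norms.L2Operator BigOperators

namespace Summit.QuantumFields.YangMills.Theorems.Prop7StraightTubeAverage

open Literature.MathematicalPhysics.QuantumFieldTheory.Balaban1983to89
open B7Prop1Explicit (e hol seg hol_seg_succ seg_zero hol_nil)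
open B7Eq78Linearization (conjR conjR_apply conjR_sub conjR_smul_real conjR_add conjR_smul)
open B7Prop3GeneralRotated (conjR_mul_left)

/-! ## §1 Telescoping of the transported covariant derivative along a straight run -/

section Telescope

variable {d : ℕ} {𝔸 : Type*} [NormedRing 𝔸] [NormedAlgebra ℂ 𝔸]

/-- ★ **TELESCOPING ALONG THE STRAIGHT RUN** ((3.114) p. 418 mechanism): transporting the forward covariant differences `η⁻¹(V_b μ(b₊) V_b⁻¹ − μ(b₋))` of the `m` bonds
`b = ⟨x + j e_κ, κ⟩` back to the start of the run through `P·V(x; seg_κ j)` and summing gives `η⁻¹(P·V(x; seg_κ m) μ(x + m e_κ) (…)⁻¹ − P μ(x) P⁻¹)`.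
[cite: Balaban1985BackgroundPropagators, (3.114) p.418; Balaban1985Averaging, (9) p.18] -/
theorem tube_telescope (V : B7Prop1Explicit.Site d → Fin d → 𝔸ˣ) (P : 𝔸ˣ) (μ : B7Prop1Explicit.Site d → 𝔸) (x : B7Prop1Explicit.Site d) (κ : Fin d) (η : ℝ) :
    ∀ m : ℕ, ∑ j ∈ Finset.range m, conjR (P * hol V x (seg κ (j : ℤ)))
        (η⁻¹ • (conjR (V (x + (j : ℤ) • e κ) κ) (μ (x + ((j : ℤ) + 1) • e κ)) - μ (x + (j : ℤ) • e κ)))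
      = η⁻¹ • (conjR (P * hol V x (seg κ (m : ℤ))) (μ (x + (m : ℤ) • e κ)) - conjR P (μ x))
  | 0 => by
    rw [Finset.sum_range_zero, Nat.cast_zero, seg_zero, hol_nil, mul_one, zero_smul, add_zero, sub_self, smul_zero]
  | m + 1 => by
    rw [Finset.sum_range_succ, tube_telescope V P μ x κ η m, conjR_smul_real, ← smul_add, Nat.cast_succ, hol_seg_succ, ← mul_assoc, conjR_sub,
      conjR_mul_left (P * hol V x (seg κ (m : ℤ))) (V (x + (m : ℤ) • e κ) κ)]
    congr 1
    abel

end Telescope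

/-! ## §2 The member: the tube letter `T = η • toL2B ∘ TS_W ∘ toL2⁻¹`, its pointwise formula, and `ℓ³‖T f‖² ≤ (cB∕c₀)‖f‖²` -/

section Member

open Literature.MathematicalPhysics.QuantumFieldTheory.Balaban1983to89.T3ContinuumYM3Torus
open Literature.MathematicalPhysics.QuantumLattice (blockMap)
open B7Prop1Explicit renaming Site → LSite
open B7Prop2Explicit (unitaryUnits hol_mem_of C0 c2')
open T3PrintedRegularMinimiser (RegPr)
open B8Eq119TwistedAxial (bgT)
open B9B8AveragingKernelZd (blockIter mem_blockIter_iff card_blockIter compT compT_zero compT_succ)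
open B10Eq27TorusAxialLog (transl transl_add pull)
open B10StarCount (sum_pbond)
open T4TermwiseTorus (tcls tlift box mem_box tlift_mem_box tlift_tcls_of_mem_box tcls_tlift)
open T3SectALandauChart (bgUnits eta eta_pos)
open T3LevelShift (siteShift bondShift)
open T3PrintedRegularOrbits (sites_eq)
open B11Eq103H1Complex (BondL2K)
open B9Eq311L2Pairing (WL2)
open Summit.QuantumFields.YangMills.Theorems.Prop7SectET3Transport (periodsT3 bondEquiv)
open Summit.QuantumFields.YangMills.Theorems.Prop7SectET3HilbertLetters (W₂ frobEquiv toL2 toL2B toL2B_apply adW adW_apply)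
open Summit.QuantumFields.YangMills.Theorems.Prop7SPrint (basePt)
open Summit.QuantumFields.YangMills.Theorems.Prop7QprimeCombL2 (sitesPerDir_zero_eq)
open Summit.QuantumFields.YangMills.Theorems.Prop7LandauCombDict (sum_univ_eq_sum_box_transl)
open Summit.QuantumFields.YangMills.Theorems.Prop7SPrintIn19 (pow_mul_eta)
open Summit.QuantumFields.YangMills.Theorems.Prop7DeltaEtaAlmostPositive (norm_toL2_sq)
open Summit.QuantumFields.YangMills.Theorems.Prop7QprimeCombBumpSectionRows (iterate_blockMap_mem_box_iff transl_zero_eq_tcls)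
open Summit.QuantumFields.YangMills.Theorems.PoincareLipschitzCovariantBridge (norm_adW)
open Summit.QuantumFields.YangMills.Theorems.Prop7TwistedIntertwining (norm_sq_toL2B)

/-- **UNITARY TRANSPORTS ARE FROBENIUS ISOMETRIES**: `‖P X P⁻¹‖_F = ‖X‖_F` for `P` unitary. [cite: Balaban1985Averaging, (18) p.21] -/
theorem norm_frobEquiv_symm_conjR (P : (Matrix (Fin 2) (Fin 2) ℂ)ˣ) (hP : P ∈ unitaryUnits (Matrix (Fin 2) (Fin 2) ℂ)) (X : Matrix (Fin 2) (Fin 2) ℂ) :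
    ‖(frobEquiv.symm (conjR P X) : W₂)‖ = ‖(frobEquiv.symm X : W₂)‖ := by
  have hP' : (((P⁻¹ : (Matrix (Fin 2) (Fin 2) ℂ)ˣ) : Matrix (Fin 2) (Fin 2) ℂ)) = star (P : Matrix (Fin 2) (Fin 2) ℂ) :=
    Units.inv_eq_of_mul_eq_one_left (Unitary.star_mul_self_of_mem hP)
  rw [conjR_apply, ← adW_apply, norm_adW P hP']

variable {d : ℕ} {𝔸 : Type*} [NormedRing 𝔸] in
/-- The composite comb transporter lies in any subgroup containing the one-step legs. [cite: Balaban1985BackgroundPropagators, (3.19) p.393] -/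
theorem compT_mem_of (L : ℕ) {S : Subgroup 𝔸ˣ} {T : ℕ → LSite d → LSite d → 𝔸ˣ} :
    ∀ k : ℕ, (∀ j, j < k → ∀ y x, T j y x ∈ S) → ∀ y x, compT L T k y x ∈ S
  | 0, _, y, x => by rw [compT_zero]; exact S.one_mem
  | k + 1, hT, y, x => by
    rw [compT_succ]
    exact S.mul_mem (hT k (Nat.lt_succ_self k) _ _) (compT_mem_of L k (fun j hj => hT j (Nat.lt_succ_of_lt hj)) _ _)

variable {d : ℕ} in
/-- **THE BLOCKS OF ONE COARSE PERIOD CELL TILE THE FINE PERIOD CELL**: `Σ_{y ∈ [0,N)ᵈ} Σ_{x ∈ Bᵏ(y)} g x = Σ_{z ∈ [0,LᵏN)ᵈ} g z`. [cite: Balaban1985Averaging, (78) p.30] -/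
theorem sum_box_sum_blockIter_eq {M : Type*} [AddCommMonoid M] (L : ℕ) [NeZero L] (k N : ℕ) (g : LSite d → M) :
    ∑ y ∈ box (d := d) N, ∑ x ∈ blockIter L k y, g x = ∑ z ∈ box (d := d) (L ^ k * N), g z := by
  classical
  rw [← Finset.sum_fiberwise_of_maps_to (s := box (d := d) (L ^ k * N)) (t := box (d := d) N) (g := fun z => (blockMap L)^[k] z)
    (fun z hz => (iterate_blockMap_mem_box_iff L k N z).1 hz)]
  refine Finset.sum_congr rfl fun y hy => Finset.sum_congr ?_ fun _ _ => rfl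
  ext z
  rw [Finset.mem_filter, mem_blockIter_iff]
  exact ⟨fun hz => ⟨(iterate_blockMap_mem_box_iff L k N z).2 (hz ▸ hy), hz⟩, fun hz => hz.2⟩

variable (F : T3Family) {n K : ℕ} (h : n ≤ K)

/-- Sums over the comparison torus `T⁽ᵏ⁾` read through `tlift` are sums over the period cell `[0,N_k)³`. [cite: Balaban1985RegularSpaces, p.77] -/
theorem sum_univ_comp_tlift_eq_sum_box {M : Type*} [AddCommMonoid M] (G : LSite (F.P K).d → M) :
    ∑ Y : Site (F.P K) (K - n), G (tlift Y) = ∑ y ∈ box (d := (F.P K).d) ((F.P K).sitesPerDir (K - n)), G y := by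
  rw [sum_univ_eq_sum_box_transl (0 : Site (F.P K) (K - n))]
  refine Finset.sum_congr rfl fun z hz => ?_
  rw [transl_zero_eq_tcls, tlift_tcls_of_mem_box hz]

/-- Sums over the fine period cell, translated and based, are sums over the fine torus. [cite: Balaban1985RegularSpaces, p.77] -/
theorem sum_box_comp_transl_add_eq_sum_univ {M : Type*} [AddCommMonoid M] (v : LSite (F.P K).d) (f : Site (F.P K) 0 → M) :
    ∑ z ∈ box (d := (F.P K).d) ((F.P K).sitesPerDir 0), f (transl (basePt F n K) (z + v)) = ∑ s : Site (F.P K) 0, f s := by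
  rw [sum_univ_eq_sum_box_transl (transl (basePt F n K) v) f]
  refine Finset.sum_congr rfl fun z _ => ?_
  rw [add_comm, transl_add]

/-- ★ **EVERY FINE BOND IS READ BY EXACTLY `ℓ` TUBE PAIRS `(x, j)`**: `Σ_{(Y,κ)} Σ_{x ∈ Bᵏ(Y)} Σ_{j<ℓ} g(x + j e_κ, κ) = ℓ · Σ_{b} g b` (read on the torus through `transl x₀`).
[cite: Balaban1984PropagatorsI, (1.18)–(1.20) p.20; Balaban1985Averaging, (78) p.30] -/
theorem sum_tube_read_eq (hnK : n ≤ K) (g : PBond (F.P K) 0 → ℝ) :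
    ∑ c : PBond (F.P K) (K - n), ∑ x ∈ blockIter (F.P K).L (K - n) (tlift c.src), ∑ j ∈ Finset.range ((F.P K).L ^ (K - n)),
        g ⟨transl (basePt F n K) (x + (j : ℤ) • e c.dir), c.dir⟩
      = ((F.P K).L ^ (K - n) : ℕ) * ∑ b : PBond (F.P K) 0, g b := by
  haveI : NeZero (F.P K).L := ⟨by have h1 := F.hL.2; show F.L ≠ 0; omega⟩
  rw [sum_pbond, sum_pbond (P := F.P K) (i := 0)]
  -- bring `κ` and `j` outside
  have h1 : ∀ Y : Site (F.P K) (K - n),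
      ∑ κ : Fin (F.P K).d, ∑ x ∈ blockIter (F.P K).L (K - n) (tlift Y), ∑ j ∈ Finset.range ((F.P K).L ^ (K - n)),
          g ⟨transl (basePt F n K) (x + (j : ℤ) • e κ), κ⟩
        = ∑ κ : Fin (F.P K).d, ∑ j ∈ Finset.range ((F.P K).L ^ (K - n)), ∑ x ∈ blockIter (F.P K).L (K - n) (tlift Y),
          g ⟨transl (basePt F n K) (x + (j : ℤ) • e κ), κ⟩ :=
    fun Y => Finset.sum_congr rfl fun κ _ => Finset.sum_comm
  rw [Finset.sum_congr rfl fun Y _ => h1 Y, Finset.sum_comm]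
  simp_rw [Finset.sum_comm (s := Finset.univ (α := Site (F.P K) (K - n))) (t := Finset.range _)]
  -- the inner `(Y, x)`-sum is a sum over the fine torus
  have h2 : ∀ (κ : Fin (F.P K).d) (j : ℕ),
      ∑ Y : Site (F.P K) (K - n), ∑ x ∈ blockIter (F.P K).L (K - n) (tlift Y), g ⟨transl (basePt F n K) (x + (j : ℤ) • e κ), κ⟩
        = ∑ s : Site (F.P K) 0, g ⟨s, κ⟩ := by
    intro κ j
    rw [sum_univ_comp_tlift_eq_sum_box F (G := fun y => ∑ x ∈ blockIter (F.P K).L (K - n) y, g ⟨transl (basePt F n K) (x + (j : ℤ) • e κ), κ⟩),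
      sum_box_sum_blockIter_eq, ← sitesPerDir_zero_eq F n K hnK,
      sum_box_comp_transl_add_eq_sum_univ F (v := (j : ℤ) • e κ) (f := fun s => g ⟨s, κ⟩)]
  simp_rw [h2, Finset.sum_const, Finset.card_range, nsmul_eq_mul]
  rw [← Finset.mul_sum, Finset.sum_comm]

/-- ★★★ **(B3-TUBE) T-1 — THE STRAIGHT COVARIANT TUBE AVERAGE AS A LINEAR MAP INTO `Qkc`'s CODOMAIN, WITH ITS POINTWISE FORMULA AND `CA = 1`.**  For `W` whose comb-leg
transporters `W̄ʲ(Γ)` (`j < k`) are unitary (on `RegPr`: ✓`LandauCombDict.bgT_pull_mem_unitaryUnits_of_regPr`) there is `T : BondL2K → WL2(cB)` with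
(i) `T(toL2 A)` read at the coarse bond `c` (through `bondShift⁻¹`, as in (B3a)) `= frobEquiv⁻¹ (η • TS_W A c)`,
`TS_W A c = (ℓ³)⁻¹ • Σ_{x ∈ Bᵏ(c₋)} Σ_{j<ℓ} conjR (compT L (bgT L W♯) k c₋ x · W♯(x; seg_{κ} j)) (A ⟨x₀ + x + j e_κ, κ⟩)` (`κ = c.dir`, `W♯ = pull (bgUnits W) x₀`), and
(ii) `ℓ³·‖T f‖² ≤ (cB∕c₀)·‖f‖²` for every `f` (unitary transports are Frobenius isometries; Cauchy–Schwarz over the `ℓ⁴` reads of a tube; every fine bond is read `ℓ` times; `ℓη = 1`).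
[cite: Balaban1985BackgroundPropagators, (3.14)–(3.16) p.393; Balaban1984PropagatorsI, (1.18)–(1.20) p.20; Balaban1985Averaging, (9) p.18, (78) p.30] -/
theorem exists_tubeAvg (c₀ cB : ℝ) [Fact (0 < c₀)] [Fact (0 < cB)] (W : GaugeField (F.P K) 0 (Matrix.specialUnitaryGroup (Fin 2) ℂ))
    (hbg : ∀ j, j < K - n → ∀ z y : LSite (F.P K).d,
      bgT (F.P K).L (pull (bgUnits F K W) (basePt F n K)) j z y ∈ unitaryUnits (Matrix (Fin 2) (Fin 2) ℂ)) :
    ∃ T : BondL2K ℂ 3 (periodsT3 F K) c₀ W₂ →ₗ[ℂ] WL2 ℂ (fun _ : PBond (F.P n) 0 => cB) W₂,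
      (∀ (A : PBond (F.P K) 0 → Matrix (Fin 2) (Fin 2) ℂ) (c : PBond (F.P K) (K - n)),
          WL2.equiv ℂ (fun _ : PBond (F.P n) 0 => cB) W₂ (T (toL2 F K c₀ A)) ((bondShift (sites_eq F n K h)).symm c)
            = frobEquiv.symm ((((eta F n K : ℝ) : ℂ)) • (((((F.P K).L : ℂ) ^ (K - n)) ^ 3)⁻¹ •
                ∑ x ∈ blockIter (F.P K).L (K - n) (tlift c.src), ∑ j ∈ Finset.range ((F.P K).L ^ (K - n)),
                  conjR (compT (F.P K).L (bgT (F.P K).L (pull (bgUnits F K W) (basePt F n K))) (K - n) (tlift c.src) x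
                      * hol (pull (bgUnits F K W) (basePt F n K)) x (seg c.dir (j : ℤ)))
                    (A ⟨transl (basePt F n K) (x + (j : ℤ) • e c.dir), c.dir⟩)))) ∧
      (∀ f, (((F.P K).L : ℝ) ^ (K - n)) ^ 3 * ‖T f‖ ^ 2 ≤ (cB / c₀) * ‖f‖ ^ 2) := by
  classical
  haveI : NeZero (F.P K).L := ⟨by have h1 := F.hL.2; show F.L ≠ 0; omega⟩
  have hc₀ : 0 < c₀ := Fact.out
  have hcB : 0 < cB := Fact.out
  set V : LSite (F.P K).d → Fin (F.P K).d → (Matrix (Fin 2) (Fin 2) ℂ)ˣ := pull (bgUnits F K W) (basePt F n K) with hVdef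
  have hVu : ∀ z κ, V z κ ∈ unitaryUnits (Matrix (Fin 2) (Fin 2) ℂ) := fun z κ =>
    Summit.QuantumFields.YangMills.Theorems.Prop7LandauCombDict.pull_bgUnits_mem_unitaryUnits W (basePt F n K) z κ
  -- the letters `ℓ = Lᵏ` (as a real number) and `ℓη = 1`
  set ℓr : ℝ := ((F.P K).L : ℝ) ^ (K - n) with hℓr
  have hℓpos : 0 < ℓr := by rw [hℓr]; exact pow_pos (by exact_mod_cast Nat.pos_of_ne_zero (NeZero.ne (F.P K).L)) _
  have hℓη : ℓr * eta F n K = 1 := pow_mul_eta F n K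
  have hℓC : ((((F.P K).L : ℂ) ^ (K - n)) ^ 3)⁻¹ = (((ℓr ^ 3)⁻¹ : ℝ) : ℂ) := by rw [hℓr]; push_cast; rfl
  -- the tube sum
  set TS : (PBond (F.P K) 0 → Matrix (Fin 2) (Fin 2) ℂ) → PBond (F.P K) (K - n) → Matrix (Fin 2) (Fin 2) ℂ := fun A c =>
    ((((F.P K).L : ℂ) ^ (K - n)) ^ 3)⁻¹ •
      ∑ x ∈ blockIter (F.P K).L (K - n) (tlift c.src), ∑ j ∈ Finset.range ((F.P K).L ^ (K - n)),
        conjR (compT (F.P K).L (bgT (F.P K).L V) (K - n) (tlift c.src) x * hol V x (seg c.dir (j : ℤ)))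
          (A ⟨transl (basePt F n K) (x + (j : ℤ) • e c.dir), c.dir⟩) with hTS
  -- it is linear in `A`
  let Lts : (PBond (F.P K) 0 → Matrix (Fin 2) (Fin 2) ℂ) →ₗ[ℂ] (PBond (F.P n) 0 → Matrix (Fin 2) (Fin 2) ℂ) :=
    { toFun := fun A c' => TS A (bondShift (sites_eq F n K h) c')
      map_add' := fun A B => by
        funext c'
        simp only [hTS, Pi.add_apply, conjR_add, Finset.sum_add_distrib, smul_add]
      map_smul' := fun a A => by
        funext c'
        simp only [hTS, Pi.smul_apply, conjR_smul, ← Finset.smul_sum, RingHom.id_apply]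
        rw [smul_comm] }
  have hLts : ∀ A c', Lts A c' = TS A (bondShift (sites_eq F n K h) c') := fun A c' => rfl
  refine ⟨(((eta F n K : ℝ) : ℂ)) • ((toL2B F n cB).toLinearMap ∘ₗ Lts ∘ₗ (toL2 F K c₀).symm.toLinearMap), fun A c => ?_, fun f => ?_⟩
  · -- (i) the pointwise formula
    rw [LinearMap.smul_apply, LinearMap.comp_apply, LinearMap.comp_apply, LinearEquiv.coe_toLinearMap, LinearEquiv.coe_toLinearMap,
      LinearEquiv.symm_apply_apply, WL2.equiv_smul, Pi.smul_apply, toL2B_apply, hLts, Equiv.apply_symm_apply, ← map_smul]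
  · -- (ii) the operator norm
    obtain ⟨A, rfl⟩ : ∃ A, f = toL2 F K c₀ A := ⟨(toL2 F K c₀).symm f, ((toL2 F K c₀).apply_symm_apply f).symm⟩
    have hTf : ((((eta F n K : ℝ) : ℂ)) • ((toL2B F n cB).toLinearMap ∘ₗ Lts ∘ₗ (toL2 F K c₀).symm.toLinearMap)) (toL2 F K c₀ A)
        = (((eta F n K : ℝ) : ℂ)) • toL2B F n cB (Lts A) := by
      rw [LinearMap.smul_apply, LinearMap.comp_apply, LinearMap.comp_apply, LinearEquiv.coe_toLinearMap, LinearEquiv.coe_toLinearMap,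
        LinearEquiv.symm_apply_apply]
    rw [hTf, norm_smul, mul_pow, Complex.norm_real, Real.norm_of_nonneg (eta_pos F n K).le, norm_sq_toL2B, norm_toL2_sq]
    -- per coarse bond: Cauchy–Schwarz over the `ℓ³·ℓ` reads, unitary transports
    have hper : ∀ c : PBond (F.P K) (K - n),
        ‖(frobEquiv.symm (TS A c) : W₂)‖ ^ 2
          ≤ (ℓr ^ 2)⁻¹ * ∑ x ∈ blockIter (F.P K).L (K - n) (tlift c.src), ∑ j ∈ Finset.range ((F.P K).L ^ (K - n)),
              ‖(frobEquiv.symm (A ⟨transl (basePt F n K) (x + (j : ℤ) • e c.dir), c.dir⟩) : W₂)‖ ^ 2 := by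
      intro c
      -- the transporters are unitary
      have hP : ∀ (x : LSite (F.P K).d) (j : ℕ),
          compT (F.P K).L (bgT (F.P K).L V) (K - n) (tlift c.src) x * hol V x (seg c.dir (j : ℤ)) ∈ unitaryUnits (Matrix (Fin 2) (Fin 2) ℂ) :=
        fun x j => Subgroup.mul_mem _ (compT_mem_of (F.P K).L (K - n) hbg _ _) (hol_mem_of hVu x _)
      -- `‖TS A c‖_F ≤ ℓ⁻³ Σ Σ ‖A‖_F`
      have h1 : ‖(frobEquiv.symm (TS A c) : W₂)‖
          ≤ (ℓr ^ 3)⁻¹ * ∑ x ∈ blockIter (F.P K).L (K - n) (tlift c.src), ∑ j ∈ Finset.range ((F.P K).L ^ (K - n)),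
              ‖(frobEquiv.symm (A ⟨transl (basePt F n K) (x + (j : ℤ) • e c.dir), c.dir⟩) : W₂)‖ := by
        rw [hTS]
        dsimp only
        rw [hℓC, map_smul, map_sum, norm_smul, Complex.norm_real, Real.norm_of_nonneg (by positivity)]
        refine mul_le_mul_of_nonneg_left ((norm_sum_le _ _).trans (Finset.sum_le_sum fun x _ => ?_)) (by positivity)
        rw [map_sum]
        refine (norm_sum_le _ _).trans (Finset.sum_le_sum fun j _ => ?_)
        rw [norm_frobEquiv_symm_conjR _ (hP x j)]
      have h0 : 0 ≤ ‖(frobEquiv.symm (TS A c) : W₂)‖ := norm_nonneg _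
      -- square and Cauchy–Schwarz twice
      have hcard : ((blockIter (F.P K).L (K - n) (tlift c.src)).card : ℝ) = ℓr ^ 3 := by
        rw [card_blockIter, hℓr, T3Family.P_d]; push_cast; ring
      have h2 : (∑ x ∈ blockIter (F.P K).L (K - n) (tlift c.src), ∑ j ∈ Finset.range ((F.P K).L ^ (K - n)),
              ‖(frobEquiv.symm (A ⟨transl (basePt F n K) (x + (j : ℤ) • e c.dir), c.dir⟩) : W₂)‖) ^ 2
          ≤ ℓr ^ 3 * (ℓr * ∑ x ∈ blockIter (F.P K).L (K - n) (tlift c.src), ∑ j ∈ Finset.range ((F.P K).L ^ (K - n)),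
              ‖(frobEquiv.symm (A ⟨transl (basePt F n K) (x + (j : ℤ) • e c.dir), c.dir⟩) : W₂)‖ ^ 2) := by
        refine (sq_sum_le_card_mul_sum_sq).trans ?_
        rw [hcard]
        refine mul_le_mul_of_nonneg_left ?_ (by positivity)
        rw [Finset.mul_sum]
        refine Finset.sum_le_sum fun x _ => (sq_sum_le_card_mul_sum_sq).trans ?_
        rw [Finset.card_range, hℓr]; push_cast; exact le_rfl
      calc ‖(frobEquiv.symm (TS A c) : W₂)‖ ^ 2
          ≤ ((ℓr ^ 3)⁻¹ * ∑ x ∈ blockIter (F.P K).L (K - n) (tlift c.src), ∑ j ∈ Finset.range ((F.P K).L ^ (K - n)),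
              ‖(frobEquiv.symm (A ⟨transl (basePt F n K) (x + (j : ℤ) • e c.dir), c.dir⟩) : W₂)‖) ^ 2 := pow_le_pow_left₀ h0 h1 2
        _ ≤ (ℓr ^ 3)⁻¹ ^ 2 * (ℓr ^ 3 * (ℓr * ∑ x ∈ blockIter (F.P K).L (K - n) (tlift c.src), ∑ j ∈ Finset.range ((F.P K).L ^ (K - n)),
              ‖(frobEquiv.symm (A ⟨transl (basePt F n K) (x + (j : ℤ) • e c.dir), c.dir⟩) : W₂)‖ ^ 2)) := by
            rw [mul_pow]; exact mul_le_mul_of_nonneg_left h2 (by positivity)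
        _ = (ℓr ^ 2)⁻¹ * ∑ x ∈ blockIter (F.P K).L (K - n) (tlift c.src), ∑ j ∈ Finset.range ((F.P K).L ^ (K - n)),
              ‖(frobEquiv.symm (A ⟨transl (basePt F n K) (x + (j : ℤ) • e c.dir), c.dir⟩) : W₂)‖ ^ 2 := by
            field_simp
    -- sum over the coarse bonds: reindex through `bondShift`, then count
    have hsum : ∑ c' : PBond (F.P n) 0, ‖(frobEquiv.symm (Lts A c') : W₂)‖ ^ 2
        = ∑ c : PBond (F.P K) (K - n), ‖(frobEquiv.symm (TS A c) : W₂)‖ ^ 2 :=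
      Fintype.sum_equiv (bondShift (sites_eq F n K h)) _ _ fun c' => rfl
    have hcount := sum_tube_read_eq F h (fun b => ‖(frobEquiv.symm (A b) : W₂)‖ ^ 2)
    have htot : ∑ c : PBond (F.P K) (K - n), ‖(frobEquiv.symm (TS A c) : W₂)‖ ^ 2
        ≤ (ℓr ^ 2)⁻¹ * (ℓr * ∑ b : PBond (F.P K) 0, ‖(frobEquiv.symm (A b) : W₂)‖ ^ 2) := by
      refine (Finset.sum_le_sum fun c _ => hper c).trans ?_
      rw [← Finset.mul_sum, hcount, hℓr]; push_cast; rfl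
    rw [hsum]
    have hS0 : 0 ≤ ∑ b : PBond (F.P K) 0, ‖(frobEquiv.symm (A b) : W₂)‖ ^ 2 := Finset.sum_nonneg fun b _ => by positivity
    have hη : eta F n K = ℓr⁻¹ := eq_inv_of_mul_eq_one_right hℓη
    have hℓ0 : ℓr ≠ 0 := hℓpos.ne'
    have hc0 : c₀ ≠ 0 := hc₀.ne'
    rw [hη]
    calc ℓr ^ 3 * (ℓr⁻¹ ^ 2 * (cB * ∑ c : PBond (F.P K) (K - n), ‖(frobEquiv.symm (TS A c) : W₂)‖ ^ 2))
        ≤ ℓr ^ 3 * (ℓr⁻¹ ^ 2 * (cB * ((ℓr ^ 2)⁻¹ * (ℓr * ∑ b : PBond (F.P K) 0, ‖(frobEquiv.symm (A b) : W₂)‖ ^ 2)))) := by gcongr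
      _ = cB / c₀ * (c₀ * ∑ b : PBond (F.P K) 0, ‖(frobEquiv.symm (A b) : W₂)‖ ^ 2) := by field_simp

/-- ★★ **THE TUBE AVERAGE ON THE PRINTED-REGULAR CLASS**: at `W ∈ 𝔘_k(a)` (`RegPr F n K a W`, `0 < a`, L-only windows `C₀(3)·2a ≤ ⅓`, `4a ≤ c₂′(3,L)` — the letters of
✓`LandauCombDict.bgT_pull_mem_unitaryUnits_of_regPr`) the tube letter `T` of `exists_tubeAvg` exists with its pointwise formula and `ℓ³·‖T f‖² ≤ (cB∕c₀)·‖f‖²`.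
[cite: Balaban1985BackgroundPropagators, (3.14)–(3.16) p.393; Balaban1985Averaging, (52)–(53) p.26, (78)–(80) p.30] -/
theorem exists_tubeAvg_of_regPr (c₀ cB : ℝ) [Fact (0 < c₀)] [Fact (0 < cB)] {a : ℝ} (ha : 0 < a) (hα3 : C0 (F.P K).d * (2 * a) ≤ 1 / 3)
    (hα4 : 4 * a ≤ c2' (F.P K).d (F.P K).L) (W : GaugeField (F.P K) 0 (Matrix.specialUnitaryGroup (Fin 2) ℂ)) (hreg : RegPr F n K a W) :
    ∃ T : BondL2K ℂ 3 (periodsT3 F K) c₀ W₂ →ₗ[ℂ] WL2 ℂ (fun _ : PBond (F.P n) 0 => cB) W₂,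
      (∀ (A : PBond (F.P K) 0 → Matrix (Fin 2) (Fin 2) ℂ) (c : PBond (F.P K) (K - n)),
          WL2.equiv ℂ (fun _ : PBond (F.P n) 0 => cB) W₂ (T (toL2 F K c₀ A)) ((bondShift (sites_eq F n K h)).symm c)
            = frobEquiv.symm ((((eta F n K : ℝ) : ℂ)) • (((((F.P K).L : ℂ) ^ (K - n)) ^ 3)⁻¹ •
                ∑ x ∈ blockIter (F.P K).L (K - n) (tlift c.src), ∑ j ∈ Finset.range ((F.P K).L ^ (K - n)),
                  conjR (compT (F.P K).L (bgT (F.P K).L (pull (bgUnits F K W) (basePt F n K))) (K - n) (tlift c.src) x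
                      * hol (pull (bgUnits F K W) (basePt F n K)) x (seg c.dir (j : ℤ)))
                    (A ⟨transl (basePt F n K) (x + (j : ℤ) • e c.dir), c.dir⟩)))) ∧
      (∀ f, (((F.P K).L : ℝ) ^ (K - n)) ^ 3 * ‖T f‖ ^ 2 ≤ (cB / c₀) * ‖f‖ ^ 2) :=
  exists_tubeAvg F h c₀ cB W fun j hj z y =>
    Summit.QuantumFields.YangMills.Theorems.Prop7LandauCombDict.bgT_pull_mem_unitaryUnits_of_regPr F ha hα3 hα4 hreg j hj.le z y

end Member

end Summit.QuantumFields.YangMills.Theorems.Prop7StraightTubeAverage
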